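import Literature.AlgebraicGeometry.HodgeTheory.AbelianVarietyMultiplicationPullback
import HarnessLib

/-!
# Route HeckePrymWeil · crux `WeilTenfoldsSqrtMinus11` (stmt-HodgeConjecture-1262) · line
# `generic-ppav-secant-descent` · stub `stub_mulPow` (M, lead's reshape of S2) — CLOSED, unconditional

`[m]^* = mᵏ` on `Hᵏ(Y(ℂ); ℂ)` for every complex abelian variety `Y` (Mumford §1 (3), §19; Milne 1986
Thm. 15.1): the Literature theorem `complexBetti_map_nsmul_id_apply`
(`HodgeTheory/AbelianVarietyMultiplicationPullback`: naturality of iterated cup products of degree-one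
classes, `[m]^* = m` on `H¹`, and the freshly PROVED `abelianVarietyCohomologyExteriorH1_holds`,
`H• = ⋀•H¹`). VERBATIM the registered stub `stub_mulPow`; in the skeleton it feeds the landed glue
`stub_moduliReachGlue` (isogeny step `f^* g^* c = (m • 𝟙)^* c = m¹² • c`).
-/

noncomputable section

-- single-problem summit (Problem = Summit): the mandated namespace repeats `HodgeConjecture`.
set_option linter.dupNamespace false

open CategoryTheory Literature.AlgebraicGeometry Literature.AlgebraicGeometry.Motives
  Literature.AlgebraicGeometry.HodgeTheory

namespace Summit.HodgeConjecture.HodgeConjecture.Theorems.HeckePrymWeil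

/-- **Stub M `stub_mulPow`, CLOSED**: multiplication by `m` acts as `mᵏ` on `Hᵏ(Y(ℂ); ℂ)` of a complex
abelian variety (`complexBetti_map_nsmul_id_apply`; Mumford §1 (3), §19). -/
theorem stub_mulPow : ∀ (Y : AbelianVariety ℂ) (m k : ℕ) (y : complexBetti Y.X k),
    complexBetti.map (m • 𝟙 Y).hom.hom.hom k y = ((m : ℂ) ^ k) • y :=
  complexBetti_map_nsmul_id_apply

end Summit.HodgeConjecture.HodgeConjecture.Theorems.HeckePrymWeil

end
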